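import Summits.Ventures.LatticeQCDFlow.Exactness.FlowSamplerGroupSymmetrisationOdd
import Summits.Ventures.LatticeQCDFlow.Exactness.Phi4FlowLatticeSymmetrisation
import HarnessLib

/-!
# Lattice φ⁴: averaging ANY flow over a lattice symmetry group makes `τ_int` EXACT — and never larger — on every polynomial observable that is ODD under one group element (`M`, `M³` under a group containing the flip; `φ_x − φ_{σx}` under an involution `σ`; …)

HONEST FRAMING: exact (Metropolis-corrected) sampling algorithms for lattice gauge theory;
figures of merit are autocorrelation/cost numbers at stated couplings and volumes; no
continuum-physics claim.  (SCALAR calibration rung S0-A: not a gauge result.)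

Venture `LatticeQCDFlow` (cell pub-lqcd), topic `Exactness`; FANOUT row 2 (`s0-phi4`, FLOW arm).  NEW
WORK of the cell: the lattice instances of `FlowSamplerGroupSymmetrisationOdd` in the vocabulary of
`Phi4LatticeSymmetry` / `Phi4FlowLatticeSymmetrisation` (`latticeSymm σ c φ = c·φ∘σ⁻¹`, a finite group
`G` acting through homomorphisms `ρ : G →* Perm`, `ε : G →* ℤˣ`, `ρ(a)` automorphisms of the
couplings `J`; the AVERAGED flow `q̄(φ) = |G|⁻¹ Σ_a q̃(t_a φ)`).  For every `λ > 0`, real `J`, ANY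
positive normalised flow density `q̃`, and every `f ∈ PolyObs` that is ODD under some `t_{a₀}`
(`f ∘ t_{a₀} = −f`) with `f²` invariant under every `t_a` (every sign-covariant `f` with `χ(a₀) = −1`):

* `gibbsExpect_eq_zero_of_latticeSymm_odd` — `⟨f⟩ = 0` (so the centred observable is `f` itself);
* **`phi4LatticeAvg_tauInt_eq_of_odd`** — if the normalised autocorrelation series of `f` under the
  flow arm `imhOpPhi4 J λ q̃` is summable then under the AVERAGED arm it is summable and
  **`τ_int^{q̄}(f) = ½ + S_f(q̄)/Var f` EXACTLY**, `S_f(q) = ∫ f̃² e^{−S} r_q/(1 − r_q)` the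
  `f̃²`-weighted summed sticking odds (`r_q(φ) = ∫ (1 − acc_q(φ, φ')) q(φ') dφ'`), with
  **`S_f(q̄) ≤ S_f(q̃)`** and **`½ + S_f(q̃)/Var f ≤ τ_int^{q̃}(f)`**;
* **`phi4LatticeAvg_tauInt_le_of_odd`** — hence `τ_int^{q̄}(f) ≤ τ_int^{q̃}(f)`.

So in odd sectors the averaged arm's `τ_int` is a STICKING functional of `q̄` alone (no spectral data),
sandwiched below the flow's.  Mechanism: `q̄ ∘ t_{a₀} = q̄` by the group law (no involution needed), the
tree's exactness for odd observables under a symmetric proposal (`FlowSamplerOddObservableExact`),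
the sticking-column comparison of `FlowSamplerGroupSymmetrisationDirichlet`, and the all-lag sticking
floor (`Phi4FlowSquareIntegrableSticking`).  The magnetisation under a flip-containing group is the
case treated lag by lag in `Phi4FlowLatticeSymmetrisationMagnetisation`; here: every odd `PolyObs`.
Nothing is cited as a fact.

NOT CLAIMED: observables that are not odd under a group element (even sectors: only the inequality of
`Phi4FlowLatticeSymmetrisation` under summability); strictness; any value for any network; cost
(`|G|` density evaluations per proposal for a generic `q̃`).
-/

namespace Summit.Ventures.LatticeQCDFlow.Exactness

open Real MeasureTheory Filter Finset Topology
open Summit.Ventures.LatticeQCDFlow.Scoring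

variable {n : ℕ} {G : Type*} [Group G] [Fintype G]

/-- **An observable odd under a lattice symmetry (`ρ` a `J`-automorphism) has Gibbs mean zero.** -/
theorem gibbsExpect_eq_zero_of_latticeSymm_odd {J : Fin (n + 1) → Fin (n + 1) → ℝ}
    {σ : Equiv.Perm (Fin (n + 1))} (hJ : ∀ x y, J (σ x) (σ y) = J x y) (c : ℤˣ) (lam : ℝ)
    {f : (Fin (n + 1) → ℝ) → ℝ} (hodd : ∀ φ, f (latticeSymm σ c φ) = -f φ) :
    gibbsExpect J lam f = 0 := by
  have h := gibbsExpect_comp_latticeSymm hJ c lam f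
  have e : (fun φ => f (latticeSymm σ c φ)) = fun φ => -f φ := funext hodd
  rw [e] at h
  have hneg : gibbsExpect J lam (fun φ => -f φ) = -gibbsExpect J lam f := by
    unfold gibbsExpect
    rw [← neg_div, ← integral_neg]
    congr 1
    exact integral_congr_ae (Eventually.of_forall fun φ => by beta_reduce; ring)
  rw [hneg] at h
  linarith

/-- **ODD SECTORS: THE AVERAGED ARM'S `τ_int` IS EXACT AND SANDWICHED BELOW THE FLOW'S.**
`f ∈ PolyObs`, `f ∘ t_{a₀} = −f`, `f² ∘ t_a = f²` for all `a`; flow-arm series summable.  Then the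
averaged-arm series is summable, `τ_int^{q̄}(f) = ½ + S_f(q̄)/Var f`, `S_f(q̄) ≤ S_f(q̃)`, and
`½ + S_f(q̃)/Var f ≤ τ_int^{q̃}(f)`. -/
theorem phi4LatticeAvg_tauInt_eq_of_odd {lam : ℝ} (hlam : 0 < lam)
    {J : Fin (n + 1) → Fin (n + 1) → ℝ} {ρ : G →* Equiv.Perm (Fin (n + 1))}
    (hJ : ∀ a x y, J (ρ a x) (ρ a y) = J x y) (ε : G →* ℤˣ) {q : (Fin (n + 1) → ℝ) → ℝ}
    (hq0 : ∀ φ, 0 < q φ) (hqm : Measurable q) (hqi : Integrable q) (hq1 : ∫ φ, q φ = 1) (a₀ : G)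
    {f : (Fin (n + 1) → ℝ) → ℝ} (hf : PolyObs f)
    (hodd : ∀ φ, f (latticeSymm (ρ a₀) (ε a₀) φ) = -f φ)
    (hfsq : ∀ a φ, f (latticeSymm (ρ a) (ε a) φ) ^ 2 = f φ ^ 2)
    (hs : Summable fun k => (∫ φ, (f φ - gibbsExpect J lam f)
        * ((imhOpPhi4 J lam q)^[k + 1] (fun ψ => f ψ - gibbsExpect J lam f)) φ * gibbsWeight J lam φ)
        / ∫ φ, (f φ - gibbsExpect J lam f) ^ 2 * gibbsWeight J lam φ) :
    (Summable fun k => (∫ φ, (f φ - gibbsExpect J lam f)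
        * ((imhOpPhi4 J lam (fun ψ => (∑ a, q (latticeSymm (ρ a) (ε a) ψ)) / Fintype.card G))^[k + 1]
            (fun ψ => f ψ - gibbsExpect J lam f)) φ * gibbsWeight J lam φ)
        / ∫ φ, (f φ - gibbsExpect J lam f) ^ 2 * gibbsWeight J lam φ) ∧
    tauInt (fun k => (∫ φ, (f φ - gibbsExpect J lam f)
        * ((imhOpPhi4 J lam (fun ψ => (∑ a, q (latticeSymm (ρ a) (ε a) ψ)) / Fintype.card G))^[k]
            (fun ψ => f ψ - gibbsExpect J lam f)) φ * gibbsWeight J lam φ)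
        / ∫ φ, (f φ - gibbsExpect J lam f) ^ 2 * gibbsWeight J lam φ)
      = 1 / 2 + (∫ φ, (f φ - gibbsExpect J lam f) ^ 2 * gibbsWeight J lam φ
          * ((∫ φ', (1 - imhAcceptQ (gibbsWeight J lam)
                  (fun ψ => (∑ a, q (latticeSymm (ρ a) (ε a) ψ)) / Fintype.card G) φ φ')
                * ((∑ a, q (latticeSymm (ρ a) (ε a) φ')) / Fintype.card G))
            / (1 - ∫ φ', (1 - imhAcceptQ (gibbsWeight J lam)
                  (fun ψ => (∑ a, q (latticeSymm (ρ a) (ε a) ψ)) / Fintype.card G) φ φ')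
                * ((∑ a, q (latticeSymm (ρ a) (ε a) φ')) / Fintype.card G))))
          / ∫ φ, (f φ - gibbsExpect J lam f) ^ 2 * gibbsWeight J lam φ ∧
    ∫ φ, (f φ - gibbsExpect J lam f) ^ 2 * gibbsWeight J lam φ
          * ((∫ φ', (1 - imhAcceptQ (gibbsWeight J lam)
                  (fun ψ => (∑ a, q (latticeSymm (ρ a) (ε a) ψ)) / Fintype.card G) φ φ')
                * ((∑ a, q (latticeSymm (ρ a) (ε a) φ')) / Fintype.card G))
            / (1 - ∫ φ', (1 - imhAcceptQ (gibbsWeight J lam)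
                  (fun ψ => (∑ a, q (latticeSymm (ρ a) (ε a) ψ)) / Fintype.card G) φ φ')
                * ((∑ a, q (latticeSymm (ρ a) (ε a) φ')) / Fintype.card G)))
      ≤ ∫ φ, (f φ - gibbsExpect J lam f) ^ 2 * gibbsWeight J lam φ
          * ((∫ φ', (1 - imhAcceptQ (gibbsWeight J lam) q φ φ') * q φ')
            / (1 - ∫ φ', (1 - imhAcceptQ (gibbsWeight J lam) q φ φ') * q φ')) ∧
    1 / 2 + (∫ φ, (f φ - gibbsExpect J lam f) ^ 2 * gibbsWeight J lam φ
          * ((∫ φ', (1 - imhAcceptQ (gibbsWeight J lam) q φ φ') * q φ')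
            / (1 - ∫ φ', (1 - imhAcceptQ (gibbsWeight J lam) q φ φ') * q φ')))
          / ∫ φ, (f φ - gibbsExpect J lam f) ^ 2 * gibbsWeight J lam φ
      ≤ tauInt (fun k => (∫ φ, (f φ - gibbsExpect J lam f)
        * ((imhOpPhi4 J lam q)^[k] (fun ψ => f ψ - gibbsExpect J lam f)) φ * gibbsWeight J lam φ)
        / ∫ φ, (f φ - gibbsExpect J lam f) ^ 2 * gibbsWeight J lam φ) := by
  obtain ⟨hgm, hg2⟩ := polyObs_sq_integrable hlam J (polyObs_sub_const hf (gibbsExpect J lam f))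
  have hmean : gibbsExpect J lam f = 0 := gibbsExpect_eq_zero_of_latticeSymm_odd (hJ a₀) (ε a₀) lam hodd
  have hodd' : ∀ φ, (fun ψ => f ψ - gibbsExpect J lam f) (latticeSymm (ρ a₀) (ε a₀) φ)
      = -(fun ψ => f ψ - gibbsExpect J lam f) φ := fun φ => by
    show f (latticeSymm (ρ a₀) (ε a₀) φ) - gibbsExpect J lam f = -(f φ - gibbsExpect J lam f)
    rw [hodd, hmean]
    ring
  have hgsq' : ∀ a φ, (fun ψ => f ψ - gibbsExpect J lam f) (latticeSymm (ρ a) (ε a) φ) ^ 2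
      = (fun ψ => f ψ - gibbsExpect J lam f) φ ^ 2 := fun a φ => by
    show (f (latticeSymm (ρ a) (ε a) φ) - gibbsExpect J lam f) ^ 2 = (f φ - gibbsExpect J lam f) ^ 2
    rw [hmean, sub_zero, sub_zero, hfsq]
  rw [imhOpPhi4_eq_imhOp] at hs ⊢
  rw [imhOpPhi4_eq_imhOp]
  exact groupAvg_tauInt_eq_of_odd (μ := volume) (t := fun a => latticeSymm (ρ a) (ε a))
    (latticeSymm_family_measurePreserving ρ ε) (latticeSymm_family_mul ρ ε)
    (fun φ => gibbsWeight_pos J lam φ) (continuous_gibbsWeight J lam).measurable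
    (integrable_gibbsWeight hlam J) (latticeSymm_family_gibbsWeight hJ ε lam) hq0 hqm hqi hq1 a₀
    hgm hg2 hodd' hgsq' hs

/-- **COROLLARY: `τ_int^{q̄}(f) ≤ τ_int^{q̃}(f)` for every odd-sector `f ∈ PolyObs` with `Var f > 0`**,
under ANY flow, the left side being the explicit sticking functional `½ + S_f(q̄)/Var f`. -/
theorem phi4LatticeAvg_tauInt_le_of_odd {lam : ℝ} (hlam : 0 < lam)
    {J : Fin (n + 1) → Fin (n + 1) → ℝ} {ρ : G →* Equiv.Perm (Fin (n + 1))}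
    (hJ : ∀ a x y, J (ρ a x) (ρ a y) = J x y) (ε : G →* ℤˣ) {q : (Fin (n + 1) → ℝ) → ℝ}
    (hq0 : ∀ φ, 0 < q φ) (hqm : Measurable q) (hqi : Integrable q) (hq1 : ∫ φ, q φ = 1) (a₀ : G)
    {f : (Fin (n + 1) → ℝ) → ℝ} (hf : PolyObs f)
    (hodd : ∀ φ, f (latticeSymm (ρ a₀) (ε a₀) φ) = -f φ)
    (hfsq : ∀ a φ, f (latticeSymm (ρ a) (ε a) φ) ^ 2 = f φ ^ 2)
    (hP : 0 < ∫ φ, (f φ - gibbsExpect J lam f) ^ 2 * gibbsWeight J lam φ)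
    (hs : Summable fun k => (∫ φ, (f φ - gibbsExpect J lam f)
        * ((imhOpPhi4 J lam q)^[k + 1] (fun ψ => f ψ - gibbsExpect J lam f)) φ * gibbsWeight J lam φ)
        / ∫ φ, (f φ - gibbsExpect J lam f) ^ 2 * gibbsWeight J lam φ) :
    tauInt (fun k => (∫ φ, (f φ - gibbsExpect J lam f)
        * ((imhOpPhi4 J lam (fun ψ => (∑ a, q (latticeSymm (ρ a) (ε a) ψ)) / Fintype.card G))^[k]
            (fun ψ => f ψ - gibbsExpect J lam f)) φ * gibbsWeight J lam φ)
        / ∫ φ, (f φ - gibbsExpect J lam f) ^ 2 * gibbsWeight J lam φ)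
      ≤ tauInt (fun k => (∫ φ, (f φ - gibbsExpect J lam f)
        * ((imhOpPhi4 J lam q)^[k] (fun ψ => f ψ - gibbsExpect J lam f)) φ * gibbsWeight J lam φ)
        / ∫ φ, (f φ - gibbsExpect J lam f) ^ 2 * gibbsWeight J lam φ) := by
  obtain ⟨-, heq, hle, hfloor⟩ := phi4LatticeAvg_tauInt_eq_of_odd hlam hJ ε hq0 hqm hqi hq1 a₀ hf
    hodd hfsq hs
  rw [heq]
  have h := div_le_div_of_nonneg_right hle hP.le
  linarith

omit [Fintype G] in
/-- **Sign-covariant observables with `χ(a₀) = −1` are odd-sector observables**: `f ∘ t_a = χ(a)·f`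
with `χ(a)² = 1` gives `f² ∘ t_a = f²`, and `χ(a₀) = −1` gives `f ∘ t_{a₀} = −f`; so the two theorems
above apply to every sign sector `χ ≠ 1` of `Phi4FlowLatticeSymmetrisation` (there: only `≤`). -/
theorem odd_of_covariant {ρ : G →* Equiv.Perm (Fin (n + 1))} {ε : G →* ℤˣ} {χ : G → ℝ}
    (hχ2 : ∀ a, χ a ^ 2 = 1) {a₀ : G} (ha₀ : χ a₀ = -1) {f : (Fin (n + 1) → ℝ) → ℝ}
    (hcov : ∀ a φ, f (latticeSymm (ρ a) (ε a) φ) = χ a * f φ) :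
    (∀ φ, f (latticeSymm (ρ a₀) (ε a₀) φ) = -f φ) ∧
    ∀ a φ, f (latticeSymm (ρ a) (ε a) φ) ^ 2 = f φ ^ 2 := by
  refine ⟨fun φ => by rw [hcov, ha₀]; ring, fun a φ => ?_⟩
  rw [hcov, mul_pow, hχ2, one_mul]

end Summit.Ventures.LatticeQCDFlow.Exactness
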